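import Summits.BirchSwinnertonDyer.Rank1Residual.X1.AnomalousStrictAtP
import Summits.BirchSwinnertonDyer.Rank1Residual.Additive.GoodModelKummerOfCoatesGreenberg
import HarnessLib

/-!
# The socket at `p` for the local term at layer `n`: a class over `ℚ_∞` whose cocycle reduces to
# zero on the inertia group in `Gal(ℚ̄/ℚ_∞)` satisfies the Kummer condition at `p`
# (cell `b2b-bsdres`, unit `b2b-bsdres-eisenstein-p1`, gen 18; X1R0-GAPMAP §27.3, memo §4.5/§4.8 (R1′))

HONEST FRAMING (run/shared/lean/b2b/bsd-rank1-residual/, verbatim in every file): the goal of the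
cell is to DELETE the COMBINATION-SHAPED residual classes of the Birch–Swinnerton-Dyer formula for
ALL analytic-rank `≤ 1` elliptic curves over `ℚ` — "full BSD formula for every rank `≤ 1` curve in
class `C`" assembled STRICTLY from published theorems — so that the rank-`≤ 1` remainder becomes
exactly the CONSTRUCTION-SHAPED classes, which are TYPED (missing-input `Prop`s), NOT attempted.
This is not "finishing BSD". Sub-cell `b2b-bsdres-eisenstein-p1`: research route; NO CLAIM BEYOND
STATED CLASSES; nothing here changes a label; nothing is booked. THEOREMS ONLY; the named fact is
PUBLISHED (Greenberg 1999 Prop. 2.4 `imKummer_ge_strictCondition_goodOrdinary`, resp. the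
Coates–Greenberg record `CoatesGreenberg1996.H1_goodModelKernel_trivial` from which the tree derives it),
carried as a hypothesis.

What. V79 (`X1/AnomalousStrictAtP`, gen 15) proved the layer-`0` local hypothesis `hloc`: for a class
of `H¹(ℚ, E[p])` at an anomalous good ordinary odd `p`, the reduction of its cocycle vanishes on
`I_v ∩ Gal(ℚ̄/ℚ_∞)` (local Kronecker–Weber over `ℚ_p`), hence the class is STRICT over `ℚ_∞`,
hence (Prop. 2.4) Kummer over `ℚ_∞`. At layer `n ≥ 1` the classes live over `ℚ_n` and NOT all of
them reduce to zero on inertia (X1R0-GAPMAP §27.3: only a subgroup of index `p^a` over the Kummer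
classes does), so the vanishing must be a HYPOTHESIS — the defining property of the intermediate
local condition `𝓛_𝔭` of the layer-`n` count (`X1/GeneratorCountLayerAtP`). This file is that
socket, for ANY class of `H¹(Gal(ℚ̄/ℚ_∞), E[p^∞])` given by a cocycle `f` on `ker κ`:

* `mem_strictKer_of_forall_inertiaIn`: if `red_v(f(x)) = Õ` for every `x` in the inertia group
  `I_v ∩ ker κ` (X2's `inertiaIn`), the class of `f` is STRICT at `v ∋ p` for Greenberg's datum
  `C_v = ker red_v` (X2 `oneCocycleClass_mem_greenbergKer_of_forall_mem` + `greenbergKer_eq_strictKer`;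
  `p` good ordinary, `κ` cyclotomic);
* `mem_localKerOver_of_forall_inertiaIn`: hence it satisfies the Kummer condition over `ℚ_∞` at
  `v` (Prop. 2.4 BY NAME, `hGrK`; or `hCG`, `…_of_coatesGreenberg`).

Layer-independent: the transported class `kerH1Iso (layerToInfty y)` of a class `y` over `ℚ_n`
(n1011's `Additive/ZpTowerKernelH1`) is such a class; what the successor must supply is the
vanishing hypothesis from the local condition at the prime of `ℚ_n` over `p` (memo §4.8).

References: [GreenbergLNM1716] §2 Props. 2.2, 2.4 (pp. 73–75), §3 Lemma 3.4 (p. 89);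
[Greenberg1989] §1 p. 98; X1R0-GAPMAP §24.5, §27.3.
-/

set_option autoImplicit false

noncomputable section

open scoped Classical

universe u

open Function Field NumberField IsDedekindDomain WeierstrassCurve
  Literature.NumberTheory.EllipticCurves Literature.NumberTheory.GaloisRepresentations
  Literature.NumberTheory.EllipticCurves.Greenberg1999 Literature.NumberTheory.EllipticCurves.GreenbergSelmer
  Summit.BirchSwinnertonDyer.Rank1Residual.X2.GreenbergVatsalReductionDatum

namespace Summit.BirchSwinnertonDyer.Rank1Residual.X1.StrictAtPOfInertia

variable (W : WeierstrassCurve ℚ) [W.IsElliptic] [W.IsGloballyMinimal] (p : ℕ) [hp : Fact p.Prime]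

/-- **Strictness from vanishing on inertia.** `p` good ordinary (`hΔ`, `hord`), `κ` cyclotomic,
`v ∋ p`; `f` a continuous cocycle of `Gal(ℚ̄/ℚ_∞) = ker κ` with values in `E[p^∞]`. If
`red_v(f(x)) = Õ` for every `x ∈ I_v ∩ ker κ`, then the class of `f` is STRICT at `v` for Greenberg's
reduction datum (`C_v = ker red_v`): strict = inertia form over `ℚ_∞^{cyc}` (X2
`greenbergKer_eq_strictKer`) and the inertia form is the cocycle criterion (X2
`oneCocycleClass_mem_greenbergKer_of_forall_mem`). [cite: GreenbergLNM1716, §2 pp. 73–75]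
[cite: Greenberg1989, §1 p. 98] -/
theorem mem_strictKer_of_forall_inertiaIn (hΔ : ¬ (p : ℤ) ∣ minimalDiscriminantInt W)
    (hord : ¬ (p : ℤ) ∣ W.frobeniusTrace p) (κ : ZpExtension ℚ p) (hκ : κ.IsCyclotomic)
    (v : HeightOneSpectrum (𝓞 ℚ)) (hpv : ((p : ℕ) : 𝓞 ℚ) ∈ v.asIdeal)
    (f : contOneCocycles (discreteTopRep κ.kerSubgroup (W.geomPrimaryTorsion p)))
    (hf : ∀ x : inertiaIn κ.kerSubgroup v,
      localRed W p hpv hΔ (pointsMap W (v.adicCompletion ℚ)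
        ((f.1 (inertiaInToH κ.kerSubgroup v x) : W.geomPrimaryTorsion p) : W.geomPoints)) = 0) :
    oneCocycleClass (discreteTopRep κ.kerSubgroup (W.geomPrimaryTorsion p)) f ∈
      (reductionDatum W p hpv hΔ).strictKer κ.kerSubgroup := by
  rw [← X2.GreenbergVatsalStrictAtP.greenbergKer_eq_strictKer W p κ hκ hpv hΔ hord]
  exact X2.GreenbergVatsalSelmerLink.oneCocycleClass_mem_greenbergKer_of_forall_mem κ.kerSubgroup
    _ (reductionDatum W p hpv hΔ) f fun x ↦ (mem_reductionDatum_plus_iff W p hpv hΔ _).2 (hf x)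

/-- **The socket at `p`: vanishing on inertia ⇒ the Kummer condition over `ℚ_∞`**, Greenberg's
Prop. 2.4 BY NAME (`hGrK`). For a class over `ℚ_∞` given by a cocycle `f` on `ker κ` whose
reduction vanishes on `I_v ∩ ker κ`: `[f] ∈ localKerOver` at `v ∋ p`.
[cite: GreenbergLNM1716, §2 Prop. 2.4 (pp. 74–75)] -/
theorem mem_localKerOver_of_forall_inertiaIn (hGrK : imKummer_ge_strictCondition_goodOrdinary)
    (hΔ : ¬ (p : ℤ) ∣ minimalDiscriminantInt W) (hord : ¬ (p : ℤ) ∣ W.frobeniusTrace p)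
    (κ : ZpExtension ℚ p) (hκ : κ.IsCyclotomic) (v : HeightOneSpectrum (𝓞 ℚ))
    (hpv : ((p : ℕ) : 𝓞 ℚ) ∈ v.asIdeal)
    (f : contOneCocycles (discreteTopRep κ.kerSubgroup (W.geomPrimaryTorsion p)))
    (hf : ∀ x : inertiaIn κ.kerSubgroup v,
      localRed W p hpv hΔ (pointsMap W (v.adicCompletion ℚ)
        ((f.1 (inertiaInToH κ.kerSubgroup v x) : W.geomPrimaryTorsion p) : W.geomPoints)) = 0) :
    oneCocycleClass (discreteTopRep κ.kerSubgroup (W.geomPrimaryTorsion p)) f ∈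
      W.localKerOver p κ.kerSubgroup (v.adicCompletion ℚ) :=
  AnomalousTowerLocalCondition.mem_localKerOver_of_mem_strictKer W p hGrK hΔ hord κ hκ v hpv _
    (mem_strictKer_of_forall_inertiaIn W p hΔ hord κ hκ v hpv f hf)

/-- The same with the Coates–Greenberg record `hCG` as the named fact (Prop. 2.4 DERIVED from it in
the tree, `Additive.GoodModelLine.imKummer_ge_strictCondition_goodOrdinary_of_coatesGreenberg`).
[cite: CoatesGreenberg1996, Cor. 3.2 (through GreenbergLNM1716, Coates p. 37 (74))]
[cite: GreenbergLNM1716, §2 Prop. 2.4 (pp. 74–75)] -/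
theorem mem_localKerOver_of_forall_inertiaIn_of_coatesGreenberg
    (hCG : CoatesGreenberg1996.H1_goodModelKernel_trivial.{0})
    (hΔ : ¬ (p : ℤ) ∣ minimalDiscriminantInt W) (hord : ¬ (p : ℤ) ∣ W.frobeniusTrace p)
    (κ : ZpExtension ℚ p) (hκ : κ.IsCyclotomic) (v : HeightOneSpectrum (𝓞 ℚ))
    (hpv : ((p : ℕ) : 𝓞 ℚ) ∈ v.asIdeal)
    (f : contOneCocycles (discreteTopRep κ.kerSubgroup (W.geomPrimaryTorsion p)))
    (hf : ∀ x : inertiaIn κ.kerSubgroup v,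
      localRed W p hpv hΔ (pointsMap W (v.adicCompletion ℚ)
        ((f.1 (inertiaInToH κ.kerSubgroup v x) : W.geomPrimaryTorsion p) : W.geomPoints)) = 0) :
    oneCocycleClass (discreteTopRep κ.kerSubgroup (W.geomPrimaryTorsion p)) f ∈
      W.localKerOver p κ.kerSubgroup (v.adicCompletion ℚ) :=
  mem_localKerOver_of_forall_inertiaIn W p
    (Additive.GoodModelLine.imKummer_ge_strictCondition_goodOrdinary_of_coatesGreenberg hCG)
    hΔ hord κ hκ v hpv f hf

/-- **Every class is the class of a cocycle** (for the statement shape of the count files): a class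
`c ∈ H¹(ker κ, E[p^∞])` all of whose cocycle representatives… — it suffices to check ONE: if some
cocycle `f` of `c` reduces to zero on `I_v ∩ ker κ`, then `c` satisfies the Kummer condition at `v`.
[cite: GreenbergLNM1716, §2 Prop. 2.4 (pp. 74–75)] -/
theorem mem_localKerOver_of_exists_cocycle (hGrK : imKummer_ge_strictCondition_goodOrdinary)
    (hΔ : ¬ (p : ℤ) ∣ minimalDiscriminantInt W) (hord : ¬ (p : ℤ) ∣ W.frobeniusTrace p)
    (κ : ZpExtension ℚ p) (hκ : κ.IsCyclotomic) (v : HeightOneSpectrum (𝓞 ℚ))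
    (hpv : ((p : ℕ) : 𝓞 ℚ) ∈ v.asIdeal) (c : W.subgroupH1 p κ.kerSubgroup)
    (hc : ∃ f : contOneCocycles (discreteTopRep κ.kerSubgroup (W.geomPrimaryTorsion p)),
      oneCocycleClass _ f = c ∧ ∀ x : inertiaIn κ.kerSubgroup v,
        localRed W p hpv hΔ (pointsMap W (v.adicCompletion ℚ)
          ((f.1 (inertiaInToH κ.kerSubgroup v x) : W.geomPrimaryTorsion p) : W.geomPoints)) = 0) :
    c ∈ W.localKerOver p κ.kerSubgroup (v.adicCompletion ℚ) := by
  obtain ⟨f, rfl, hf⟩ := hc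
  exact mem_localKerOver_of_forall_inertiaIn W p hGrK hΔ hord κ hκ v hpv f hf

end Summit.BirchSwinnertonDyer.Rank1Residual.X1.StrictAtPOfInertia

end
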